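import Summits.BirchSwinnertonDyer.BirchSwinnertonDyer.Theorems.ManinLocalTwoThreeCurveExclusionFortyFour
import HarnessLib

/-!
# Level `108 = 2²·3³` (BOTH crux domains, genus `g(X₀(108)) = 10`): the CURVE-SIDE EXCLUSION ARITHMETIC

Cell `bsd-f2-manin`, route `ManinLocalTwoThree`, cruxes C2 `ManinOddAtFour` (stmt-BirchSwinnertonDyer-22967, `2² ∣ 108`) and
C3 `ManinPrimeToThreeAtNine` (stmt-BirchSwinnertonDyer-22968, `3² ∣ 108`), prover seat p1 gen 25; `--supports stmt-BirchSwinnertonDyer-22967`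
(helper).  Level-`108` analogue of `…CurveExclusionFortyFour` (whose generic curve-side lemmas `lFunction_mul`,
`neg_le_lFunction_prime_and_le` are reused).

THE PLAN AT 108 (an g51 MEMO-an §96 «pinning by the curve's own recursion», `S₂`-variant; p3 g24's request, p1 g24's groundwork).
`dim S₂(Γ₀(108)) = g(X₀(108)) = 10` and `S₂(Γ₀(108))` has the `η`-quotient basis `B1c, …, B10c` (`…BasisSolveOneHundredEight`,
pivot columns `n = 1,2,3,4,5,7,8,10,13,19`).  On that basis the reduced row-echelon form yields, among others, the four column relations
`a₁₁ = −a₅`, `a₃₅ = −a₅`, `a₄₉ = 7a₁ + 7a₇ + 3a₁₃ + 3a₁₉`, `a₅₅ = 3a₇ + 2a₁₃ + a₁₉` valid for EVERY `f ∈ S₂(Γ₀(108))`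
(`…ColumnRelationsOneHundredEight.columnRelations_oneHundredEight`), hence for `aₙ = aₙ(D.f) = W.LFunction n` of every
`X₀(108)`-datum `D`.  THIS FILE proves the purely arithmetic consequence: an elliptic `W/ℚ` whose `L`-coefficients satisfy these four
relations has `(a₅, a₇, a₁₃, a₁₉)` in the NINE-element list
`{(0,5,−7,−1)} ∪ {(0,−1,5,−7), (0,−4,2,8), (±1,−1,4,−6), (±2,−1,1,−3), (±3,−1,−4,2)}` — the vector of the newform `108a1` and eight
vectors realised by OLD forms of `S₂(Γ₀(108))` (from `27a`, `36a`, `54a`, `54b`; excluded downstream by `old ⊓ new = ⊥` and the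
landed witnesses `oldWitness108_3…10`).  Inputs: `a₁ = 1`, multiplicativity (`a₃₅ = a₅a₇`, `a₅₅ = a₅a₁₁`), the recursion
`a₄₉ = a₇² − 𝟙(7)·7` with UNKNOWN indicator (both branches), and Hasse `|a_p| ≤ 2√p` at `p = 5, 7, 13, 19` — all PROVED tree theorems;
no modular form enters.  (`a₃₅ = −a₅ = a₅a₇` splits `a₅ = 0 ∨ a₇ = −1`; `a₅₅ = −a₅²` and `a₄₉` then leave a linear system per case.)
Exact-arithmetic twins: an g51 `pinsolve-108.out` / p1 g24 `HOME/p1/g24/old_solutions_108.txt` (`P = 60`: the same nine vectors with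
`a₂ = a₃ = 0`, plus three old vectors with `a₂ ≠ 0` that the curve side never reaches).

HONEST FRAMING: elementary and unconditional; one quarter of «`|c| = 1`, `2 ∤ c`, `3 ∤ c` on `X₀(108)` fact-free» (the others: the
column relations, the newform pinning with the old witnesses, and p3's Néron squeeze `…NeronSqueezeOneHundredEight`).  Nothing here proves
C2, C3, Manin's conjecture or BSD.
[cite: DiamondShurman2005, §8.8 (8.44)] [cite: SilvermanAEC2009, Thm. V.1.1] [cite: CremonaAlgorithms1997, Table 3 (N = 27, 36, 54, 108)]
-/

set_option autoImplicit false
-- lint-debt: the directory name repeats the summit name (sibling precedent `ManinLocalTwoThreeCurveExclusionFortyFour.lean`)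
set_option linter.dupNamespace false

namespace Summit.BirchSwinnertonDyer.BirchSwinnertonDyer.Theorems.ManinLocalTwoThree.LevelOneHundredEight

open Literature.NumberTheory.EllipticCurves

variable (W : WeierstrassCurve ℚ) [W.IsElliptic]

/-! ## §1 Curve-side inputs at the primes `5, 7, 13, 19` -/

/-- `a₄₉ = a₇² − 𝟙(7)·7`. [cite: DiamondShurman2005, §8.8 (8.44)] -/
theorem lFunction_fortyNine : W.LFunction 49 = W.LFunction 7 * W.LFunction 7 -
    (if 7 ∣ W.conductorNorm ℤ then 0 else (7 : ℤ)) := by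
  have h := W.LFunction_apply_prime_pow_add_two_of_prime (show Nat.Prime 7 by norm_num) 0
  simp only [zero_add, pow_one, pow_zero, WeierstrassCurve.LFunction_apply_one, mul_one] at h
  norm_num at h
  exact h

/-- Hasse at `5, 7, 13, 19`: `|a₅| ≤ 4`, `|a₇| ≤ 5`, `|a₁₃| ≤ 7`, `|a₁₉| ≤ 8` (two-sided form). [cite: SilvermanAEC2009, Thm. V.1.1] -/
theorem hasse_bounds_oneHundredEight : (-4 ≤ W.LFunction 5 ∧ W.LFunction 5 ≤ 4) ∧ (-5 ≤ W.LFunction 7 ∧ W.LFunction 7 ≤ 5) ∧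
    (-7 ≤ W.LFunction 13 ∧ W.LFunction 13 ≤ 7) ∧ (-8 ≤ W.LFunction 19 ∧ W.LFunction 19 ≤ 8) :=
  ⟨by exact_mod_cast LevelFortyFour.neg_le_lFunction_prime_and_le W (p := 5) (B := 4) (by norm_num) (by norm_num),
   by exact_mod_cast LevelFortyFour.neg_le_lFunction_prime_and_le W (p := 7) (B := 5) (by norm_num) (by norm_num),
   by exact_mod_cast LevelFortyFour.neg_le_lFunction_prime_and_le W (p := 13) (B := 7) (by norm_num) (by norm_num),
   by exact_mod_cast LevelFortyFour.neg_le_lFunction_prime_and_le W (p := 19) (B := 8) (by norm_num) (by norm_num)⟩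

/-! ## §2 The exclusion -/

/-- **The level-108 exclusion arithmetic.**  If the `L`-coefficients of an elliptic `W/ℚ` satisfy the four column relations
`a₁₁ = −a₅`, `a₃₅ = −a₅`, `a₄₉ = 7a₁ + 7a₇ + 3a₁₃ + 3a₁₉`, `a₅₅ = 3a₇ + 2a₁₃ + a₁₉` of `S₂(Γ₀(108))`, then `(a₅, a₇, a₁₃, a₁₉)` is the
vector `(0, 5, −7, −1)` of `108a1` or one of the eight old vectors `(0,−1,5,−7)`, `(0,−4,2,8)`, `(±1,−1,4,−6)`, `(±2,−1,1,−3)`, `(±3,−1,−4,2)`.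
[cite: DiamondShurman2005, §8.8 (8.44)] [cite: CremonaAlgorithms1997, Table 3 (N = 27, 36, 54, 108)] -/
theorem coeffVector_oneHundredEight
    (h11 : W.LFunction 11 = -W.LFunction 5)
    (h35 : W.LFunction 35 = -W.LFunction 5)
    (h49 : W.LFunction 49 = 7 * W.LFunction 1 + 7 * W.LFunction 7 + 3 * W.LFunction 13 + 3 * W.LFunction 19)
    (h55 : W.LFunction 55 = 3 * W.LFunction 7 + 2 * W.LFunction 13 + W.LFunction 19) :
    (W.LFunction 5 = 0 ∧ W.LFunction 7 = 5 ∧ W.LFunction 13 = -7 ∧ W.LFunction 19 = -1) ∨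
      (W.LFunction 5 = 0 ∧ W.LFunction 7 = -1 ∧ W.LFunction 13 = 5 ∧ W.LFunction 19 = -7) ∨
      (W.LFunction 5 = 0 ∧ W.LFunction 7 = -4 ∧ W.LFunction 13 = 2 ∧ W.LFunction 19 = 8) ∨
      (W.LFunction 5 = 1 ∧ W.LFunction 7 = -1 ∧ W.LFunction 13 = 4 ∧ W.LFunction 19 = -6) ∨
      (W.LFunction 5 = -1 ∧ W.LFunction 7 = -1 ∧ W.LFunction 13 = 4 ∧ W.LFunction 19 = -6) ∨
      (W.LFunction 5 = 2 ∧ W.LFunction 7 = -1 ∧ W.LFunction 13 = 1 ∧ W.LFunction 19 = -3) ∨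
      (W.LFunction 5 = -2 ∧ W.LFunction 7 = -1 ∧ W.LFunction 13 = 1 ∧ W.LFunction 19 = -3) ∨
      (W.LFunction 5 = 3 ∧ W.LFunction 7 = -1 ∧ W.LFunction 13 = -4 ∧ W.LFunction 19 = 2) ∨
      (W.LFunction 5 = -3 ∧ W.LFunction 7 = -1 ∧ W.LFunction 13 = -4 ∧ W.LFunction 19 = 2) := by
  obtain ⟨⟨h5l, h5u⟩, ⟨h7l, h7u⟩, ⟨h13l, h13u⟩, ⟨h19l, h19u⟩⟩ := hasse_bounds_oneHundredEight W
  have hL1 : W.LFunction 1 = 1 := W.LFunction_apply_one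
  -- multiplicativity at `35, 55` and the `7`-power recursion
  have m35 : W.LFunction 35 = W.LFunction 5 * W.LFunction 7 := LevelFortyFour.lFunction_mul W (m := 5) (n := 7) (by norm_num)
  have m55 : W.LFunction 55 = W.LFunction 5 * W.LFunction 11 :=
    LevelFortyFour.lFunction_mul W (m := 5) (n := 11) (by norm_num)
  have r49 := lFunction_fortyNine W
  -- name the coefficients
  rw [hL1] at h49
  set a5 := W.LFunction 5 with ha5
  set a7 := W.LFunction 7 with ha7
  set a13 := W.LFunction 13 with ha13
  set a19 := W.LFunction 19 with ha19
  clear_value a5 a7 a13 a19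
  rw [m35] at h35
  rw [m55, h11] at h55
  rw [r49] at h49
  by_cases h50 : a5 = 0
  · -- Case `a₅ = 0`: `3a₇ + 2a₁₃ + a₁₉ = 0` and `a₇² − 𝟙(7)·7 = 7 + 7a₇ + 3a₁₃ + 3a₁₉` leave `a₇ ∈ {5, −1, −4}` (Hasse at `13, 19`)
    subst h50
    have e55 : 3 * a7 + 2 * a13 + a19 = 0 := by linear_combination -h55
    have h7v : a7 = 5 ∨ a7 = -1 ∨ a7 = -4 := by
      split_ifs at h49 with h7N <;> clear h7N <;> interval_cases a7 <;> omega
    rcases h7v with h7 | h7 | h7 <;> subst h7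
    · obtain ⟨h13, h19⟩ : a13 = -7 ∧ a19 = -1 := by split_ifs at h49 with h7N <;> clear h7N <;> omega
      subst h13 h19; norm_num
    · obtain ⟨h13, h19⟩ : a13 = 5 ∧ a19 = -7 := by split_ifs at h49 with h7N <;> clear h7N <;> omega
      subst h13 h19; norm_num
    · obtain ⟨h13, h19⟩ : a13 = 2 ∧ a19 = 8 := by split_ifs at h49 with h7N <;> clear h7N <;> omega
      subst h13 h19; norm_num
  · -- Case `a₅ ≠ 0`: `a₇ = −1`, then `7 ∤ N_W`, `a₁₃ + a₁₉ = −2`, `2a₁₃ + a₁₉ = 3 − a₅²`, and Hasse at `13` bounds `|a₅| ≤ 3`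
    have h7 : a7 = -1 := by
      have h0 : a5 * (a7 + 1) = 0 := by linear_combination h35
      rcases mul_eq_zero.mp h0 with h | h
      · exact absurd h h50
      · linear_combination h
    subst h7
    have hsum : a13 + a19 = -2 := by split_ifs at h49 with h7N <;> clear h7N <;> omega
    clear h49
    have h5v : a5 = 1 ∨ a5 = -1 ∨ a5 = 2 ∨ a5 = -2 ∨ a5 = 3 ∨ a5 = -3 := by
      interval_cases a5 <;> omega
    rcases h5v with h5 | h5 | h5 | h5 | h5 | h5 <;> subst h5
    · obtain ⟨h13, h19⟩ : a13 = 4 ∧ a19 = -6 := by omega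
      subst h13 h19; norm_num
    · obtain ⟨h13, h19⟩ : a13 = 4 ∧ a19 = -6 := by omega
      subst h13 h19; norm_num
    · obtain ⟨h13, h19⟩ : a13 = 1 ∧ a19 = -3 := by omega
      subst h13 h19; norm_num
    · obtain ⟨h13, h19⟩ : a13 = 1 ∧ a19 = -3 := by omega
      subst h13 h19; norm_num
    · obtain ⟨h13, h19⟩ : a13 = -4 ∧ a19 = 2 := by omega
      subst h13 h19; norm_num
    · obtain ⟨h13, h19⟩ : a13 = -4 ∧ a19 = 2 := by omega
      subst h13 h19; norm_num

end Summit.BirchSwinnertonDyer.BirchSwinnertonDyer.Theorems.ManinLocalTwoThree.LevelOneHundredEight
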